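import Summits.ResolutionOfSingularities.ResolutionOfSingularities.Theorems.EquisingularLiftEquisingularLiftNatNDRoundPropsP
import Summits.ResolutionOfSingularities.ResolutionOfSingularities.Theorems.EquisingularLiftEquisingularLiftNatNDTransportEnd
import HarnessLib

/-!
# [OURS · L1 W4.5(b) · EL♮(3)] ND-K5/K6 (L-β2) `ND.transportEnd₀` — ASCENT AT THE END WITHOUT AMBIENT REGULARITY, BY NAME

OURS · L1 W4.5(b) · EL♮(3) stmt-ResolutionOfSingularities-20148 (parent EL♮ stmt-…-20038) · counted 0 · AI-written (res-L1-w45b-iso-w2 g0, WIDTH seat on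
D-0157 DOOR 1; desk RULING R36/R36′ (K-reg) = LOCALISE, WIDTH TABLE D2 «K-LOC» row (L-β2)), weaker than expert review; nothing of [Hironaka2017] asserted;
no statement of the manuscript; resolution of singularities in positive characteristic is NOT proved here or by this.  Def-free, sorry-free, standard axioms.
`--supports stmt-ResolutionOfSingularities-20148 --as helper`.

WHAT.  The brick **`transportEnd₀ (n) (k) [Field k] [IsAlgClosed k] : ND.TransportEnd₀ n k`** of idea-1's SPEC K6-loc v2 §L0 (9899f83d0e925ade), BY NAME against the
text owner's port `…NatNDRoundPropsP`: `ND.TransportEnd₀` = ✓ p643982's `ND.TransportEnd` with the ambient binder `Scheme.IsRegular F₁ →` DELETED and the first output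
`IsRegular F` DELETED (the K-REG audits, STATUS 2026-08-28 16:17–16:24Z: ambient regularity of the k-stage was consumed only off `x`, to re-emit itself) — what is
left is END: the reduced strict transform of the linked F-stage is regular at every point over `x`.  PROOF = the END half of ✓ p646559 `ND.transportEnd` VERBATIM:
`ND.isRegularLocalRing_stalk_subscheme_of_linked` (✓ p645475) on `Linked`'s squares with the affine finite-type charts of the `ToricStage`
(`ND.finiteType_chart_of_toricStage`, ✓ p646559); the model's regularity `IsRegular A` is used only at points over the origin.  `κ(x)` arbitrary.
-/

set_option linter.dupNamespace false

open CategoryTheory CategoryTheory.Limits AlgebraicGeometry TopologicalSpace Topology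
open MvPolynomial TensorProduct
open Literature.AlgebraicGeometry.Resolution
open AlgebraicGeometry.Scheme.IdealSheafData

namespace Summit.ResolutionOfSingularities.ResolutionOfSingularities.Cruxes.EquisingularLiftNat.Sections.ND

/-- **(L-β2) `transportEnd₀`** — END of the F-stage over `x` from END of the linked model toric stage, with NO ambient regularity of `F₁` (SPEC K6-loc v2 §L0
signature `ND.TransportEnd₀ n k` of `…NatNDRoundPropsP` VERBATIM).  [OURS · L1 W4.5b · ND-K5/K6 (L-β2) · BY NAME] -/
theorem transportEnd₀ (n : ℕ) (k : Type) [Field k] [IsAlgClosed k] : TransportEnd₀ n k := by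
  intro F₁ ρ T₁ hLN hT₁ x hx W w g h1 h2 h3 h4 h5 F φF EF TF A φA EA TA hFS hL hTS hAreg hend
  classical
  haveI := hLN
  obtain ⟨hLNF, hiso, hTFoff, hTFcl, hEF⟩ := hFS
  obtain ⟨L, a, b, c, sqF, sqA, hE, hT⟩ := hL
  obtain ⟨Φ, hsmooth, hcharts, hisoA, hTAoff, hTAcl, hEA⟩ := hTS
  have sqA' : IsPullback b c φA (Spec.map (CommRingCat.ofHom (MvPolynomial.eval₂Hom (baseToStalk n k ρ x) w))) := sqA
  -- the affine finite-type chart at every point of the model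
  have hchartA : ∀ z : A, ∃ U : A.Opens, z ∈ U ∧ IsAffineOpen U ∧
      ((φA.appLE ⊤ U le_top).hom.comp (Scheme.ΓSpecIso (.of (MvPolynomial (Fin n) k))).inv.hom).FiniteType := by
    intro z
    obtain ⟨σ, -, B, cA, hcA, hzc, -, -, hcomp, -, -, -⟩ := hcharts z
    haveI := hcA
    refine ⟨cA ''ᵁ ⊤, ?_, (isAffineOpen_top (Aff n k)).image_of_isOpenImmersion cA, finiteType_chart_of_toricStage n k φA B cA hcomp⟩
    rw [Scheme.Hom.image_top_eq_opensRange]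
    exact hzc
  -- END over `x`
  intro z hz
  refine isRegularLocalRing_stalk_subscheme_of_linked n k ρ x w h2 h3 a b c φF φA sqF sqA'
    (vanishingIdeal (⟨closure TF, isClosed_closure⟩ : Closeds F)) (vanishingIdeal (⟨closure TA, isClosed_closure⟩ : Closeds A)) ?_ ?_
    (fun z' _ => hchartA z') hend z hz
  · have hs : (vanishingIdeal (⟨closure TF, isClosed_closure⟩ : Closeds F)).support = ⟨closure TF, isClosed_closure⟩ :=
      TopologicalSpace.Closeds.ext (Scheme.IdealSheafData.coe_support_vanishingIdeal _)
    rw [← Scheme.IdealSheafData.vanishingIdeal_support, hs]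
  · rw [Scheme.IdealSheafData.coe_support_vanishingIdeal, Scheme.IdealSheafData.coe_support_vanishingIdeal]
    change a ⁻¹' closure TF = b ⁻¹' closure TA
    rw [hTFcl.closure_eq, hTAcl.closure_eq, hT]

end Summit.ResolutionOfSingularities.ResolutionOfSingularities.Cruxes.EquisingularLiftNat.Sections.ND
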